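import Summits.QuantumFields.YangMills.Theorems.BalabanUVNodesN15KingModelPositionSpaceRepresentation
import Summits.QuantumFields.YangMills.Theorems.BalabanUVNodesN15KingModelMasslessLimit
import Mathlib.MeasureTheory.Integral.IntegralEqImproper
import Literature.MathematicalPhysics.QuantumFieldTheory.UnitaryCayleyChart

/-!
# BalabanUVNodes ∕ N15 — THE KING-MODEL RUNG (PART Ϻ-cc): THE EXACT BLOCK-SPIN RENORMALISATION-GROUP FLOW OF KING'S BLOCK FIELD — `Σ_{a,b∈[0,L)^{d+1}}S₂^{ℝ}_{m²}(Lz + a − b) = L^{d+3}S₂^{ℝ}_{L²m²}(z)`: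
# averaging the unit-lattice block field over `L`-blocks and rescaling by `L^{(d−1)∕2}` gives King's block field again with mass `Lm` (the mass is relevant with exponent `1`), and the
# massless field `μ⁰_∞` (`d + 1 ≥ 3`) is an EXACT FIXED POINT: `Σ_{a,b}S₂^{0}(Lz + a − b) = L^{d+3}S₂^{0}(z)` (Track A, DAG node N15 = NE2; FAN-OUT v1.1 §N15 s3 «KING-MODEL RUNG»; count-neutral)

HONEST FRAMING.  Count-neutral (cell `pub-ymgap`, seat `pub-ymgap-dag-n15-e` g35; `--supports stmt-QuantumFields-27366 --as helper` = K3⁸).  King's `A = 0`, `g = 0` model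
([King1986] C. King, Commun. Math. Phys. **102** (1986) 649–677): the block-spin transformation `φ ↦ φ_L(z) = L^{−(d+1)}Σ_{a∈[0,L)^{d+1}}φ(Lz + a)` followed by the rescaling
`φ_L ↦ L^{(d−1)∕2}φ_L` is the renormalisation-group map whose iteration King (after Gawędzki–Kupiainen and Bałaban) controls.  For the FREE block field everything is explicit and typed
here from the proper-time ∕ block-average representation (parts Ϻ-b∕f): in one dimension ★ `Σ_{a,b=0}^{L−1}J_t(Lx + a − b) = L·J_{t∕L²}(x)` (gluing `L` unit intervals into `[0,L]`, then
`g_t(Ly) = L⁻¹g_{t∕L²}(y)`), hence ★★ `Σ_{a,b}Π_μJ_t((Lz + a − b)_μ) = L^{d+1}Π_μJ_{t∕L²}(z_μ)` and, substituting `t = L²s` in the proper-time integral,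
★★★ **THE RG FLOW** `Σ_{a,b∈[0,L)^{d+1}}S₂^{ℝ}_{m²}(Lz + a − b) = L^{d+3}S₂^{ℝ}_{L²m²}(z)` (every `d`, `m² > 0`, `L ≥ 1`), i.e. `Cov_{μ_{∞,m}}(φ_L(z), φ_L(w)) = L^{−(d−1)}S₂^{ℝ}_{(Lm)²}(w − z)`:
the rescaled block field `L^{(d−1)∕2}φ_L` under `μ_{∞,m}` has EXACTLY the covariance of King's block field with mass `Lm`.  Letting `m ↓ 0` (part Ϻ-x, `d ≥ 2`):
★★★ **THE MASSLESS BLOCK FIELD IS A FIXED POINT** — `Σ_{a,b}S₂^{0}(Lz + a − b) = L^{d+3}S₂^{0}(z)`, `Cov_{μ⁰_∞}(φ_L(z),φ_L(w)) = L^{−(d−1)}S₂^{0}(w − z)`: the Gaussian fixed point of the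
block-spin RG with scaling dimension `(d−1)∕2`.  NOT Bałaban's objects; NOT a node discharge; nothing continuum-Yang–Mills ∕ `ℝ⁴` ∕ OS ∕ Clay.  0 `sorry`, 0 def; standard axioms.

WHAT THIS FILE PROVES (kernel).  §1 `gaussLine_mul_left`, `sum_intervalIntegral_comp_add`, `intervalIntegral_zero_nat_eq_mul`, ★ **`sum_sum_tentAvg_gaussLine_scaled`**.  §2 ★★ `sum_sum_prod_tentAvg_scaled`.
§3 ★★★ **`kingS2Inf_rg_flow`**, ★★★ **`covariance_blockSum_kingFieldInf`**.  §4 ★★★ **`kingS2Inf0_rg_fixed_point`** (the letter `t ↦ L²t : 𝓝[>]0 → 𝓝[>]0` is the tree's `UnitaryCayley.tendsto_const_mul_nhdsGT`), ★★★ **`covariance_blockSum_kingFieldInf0`**.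

HONEST SCOPE.  Covariance-level statements (the fields are centred Gaussian, so these determine the laws, but the push-forward identity of measures is not typed here).  N15 untouched;
counts unmoved.  Locators (use): [King1986] §2 (2.3)–(2.6) p.652, Thm 2.1 (2.22) p.654, (4.5) p.670.
-/

noncomputable section

open scoped BigOperators Topology
open Filter MeasureTheory Set

namespace Summit.QuantumFields.YangMills.BalabanUVNodes.N15KingModelRung.ProperTime

open Summit.QuantumFields.YangMills.BalabanUVNodes.N15KingModelRung.OptimalDecay
open Summit.QuantumFields.YangMills.BalabanUVNodes.N15KingModelRung.InfiniteVolume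
open Literature.Analysis.Fourier (tent tent_nonneg)

variable {d : ℕ}

/-! ## §1 One dimension: gluing unit intervals and Gaussian scaling -/

/-- Gaussian scaling: `g_t(Ly) = L⁻¹g_{t∕L²}(y)` (`L > 0`, `t > 0`). [folklore] -/
theorem gaussLine_mul_left {t L : ℝ} (ht : 0 < t) (hL : 0 < L) (y : ℝ) : gaussLine t (L * y) = L⁻¹ * gaussLine (t / L ^ 2) y := by
  unfold gaussLine
  have hs : Real.sqrt (4 * Real.pi * (t / L ^ 2)) = Real.sqrt (4 * Real.pi * t) / L := by
    rw [show 4 * Real.pi * (t / L ^ 2) = (4 * Real.pi * t) / L ^ 2 by ring, Real.sqrt_div' _ (pow_nonneg hL.le 2), Real.sqrt_sq hL.le]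
  have he : (L * y) ^ 2 / (4 * t) = y ^ 2 / (4 * (t / L ^ 2)) := by
    field_simp
  rw [hs, he, inv_div]
  have hsq : 0 < Real.sqrt (4 * Real.pi * t) := Real.sqrt_pos.mpr (by positivity)
  field_simp

/-- Gluing: `Σ_{a<L}∫₀¹h(a + α)dα = ∫₀^Lh` (`h` continuous). [folklore] -/
theorem sum_intervalIntegral_comp_add {h : ℝ → ℝ} (hh : Continuous h) (L : ℕ) :
    ∑ a ∈ Finset.range L, ∫ α in (0 : ℝ)..1, h ((a : ℝ) + α) = ∫ u in (0 : ℝ)..(L : ℝ), h u := by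
  have e : ∀ a : ℕ, ∫ α in (0 : ℝ)..1, h ((a : ℝ) + α) = ∫ u in (a : ℝ)..((a : ℝ) + 1), h u := fun a => by
    rw [intervalIntegral.integral_comp_add_left h (a : ℝ), add_zero]
  simp_rw [e]
  have key := intervalIntegral.sum_integral_adjacent_intervals (f := h) (μ := volume) (a := fun k : ℕ => (k : ℝ)) (n := L)
    (fun k _ => hh.intervalIntegrable _ _)
  simpa only [Nat.cast_add, Nat.cast_one, Nat.cast_zero] using key

/-- Scaling: `∫₀^LF = L∫₀¹F(Lα)dα` (`L > 0`). [folklore] -/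
theorem intervalIntegral_zero_nat_eq_mul {F : ℝ → ℝ} {L : ℝ} (hL : 0 < L) : ∫ u in (0 : ℝ)..L, F u = L * ∫ α in (0 : ℝ)..1, F (L * α) := by
  rw [intervalIntegral.integral_comp_mul_left F hL.ne', mul_zero, mul_one, smul_eq_mul, mul_inv_cancel_left₀ hL.ne']

/-- ★ **THE ONE-DIMENSIONAL BLOCK-SPIN IDENTITY**: `Σ_{a,b=0}^{L−1}J_t(Lx + a − b) = L·J_{t∕L²}(x)`, `J_t(y) = ∫Λ(u)g_t(y − u)du = ∫₀¹∫₀¹g_t(y + α − β)` (`t > 0`, `L ≥ 1`). [folklore] -/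
theorem sum_sum_tentAvg_gaussLine_scaled {t : ℝ} (ht : 0 < t) {L : ℕ} (hL : 1 ≤ L) (x : ℝ) :
    ∑ a ∈ Finset.range L, ∑ b ∈ Finset.range L, ∫ u : ℝ, tent 1 u * gaussLine t ((L : ℝ) * x + a - b - u)
      = (L : ℝ) * ∫ u : ℝ, tent 1 u * gaussLine (t / (L : ℝ) ^ 2) (x - u) := by
  have hL0 : (0 : ℝ) < L := Nat.cast_pos.mpr (by omega)
  have htL : 0 < t / (L : ℝ) ^ 2 := by positivity
  -- Step 1: block-average form of each term
  have h1 : ∀ a b : ℕ, ∫ u : ℝ, tent 1 u * gaussLine t ((L : ℝ) * x + a - b - u)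
      = ∫ α in (0 : ℝ)..1, ∫ β in (0 : ℝ)..1, gaussLine t ((L : ℝ) * x + a - b + α - β) := fun a b => tentAvg_gaussLine_eq_blockAverage ht _
  simp_rw [h1]
  -- Step 2: glue in `b` (inside the `α`-integral), then in `a`
  have hcontβ : ∀ (a b : ℕ), Continuous fun α : ℝ => ∫ β in (0 : ℝ)..1, gaussLine t ((L : ℝ) * x + a - b + α - β) := fun a b =>
    intervalIntegral.continuous_parametric_intervalIntegral_of_continuous' (by
      exact (continuous_gaussLine t).comp (by fun_prop)) 0 1
  have h2 : ∀ a : ℕ, ∑ b ∈ Finset.range L, ∫ α in (0 : ℝ)..1, ∫ β in (0 : ℝ)..1, gaussLine t ((L : ℝ) * x + a - b + α - β)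
      = ∫ α in (0 : ℝ)..1, ∫ w in (0 : ℝ)..(L : ℝ), gaussLine t ((L : ℝ) * x + a + α - w) := by
    intro a
    rw [← intervalIntegral.integral_finsetSum fun b _ => (hcontβ a b).intervalIntegrable _ _]
    refine intervalIntegral.integral_congr fun α _ => ?_
    have hg := sum_intervalIntegral_comp_add (h := fun w => gaussLine t ((L : ℝ) * x + a + α - w)) ((continuous_gaussLine t).comp (by fun_prop)) L
    rw [← hg]
    refine Finset.sum_congr rfl fun b _ => intervalIntegral.integral_congr fun β _ => ?_
    ring_nf
  simp_rw [h2]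
  have hcontw : Continuous fun u : ℝ => ∫ w in (0 : ℝ)..(L : ℝ), gaussLine t ((L : ℝ) * x + u - w) :=
    intervalIntegral.continuous_parametric_intervalIntegral_of_continuous' (by exact (continuous_gaussLine t).comp (by fun_prop)) 0 L
  have h3 : ∑ a ∈ Finset.range L, ∫ α in (0 : ℝ)..1, ∫ w in (0 : ℝ)..(L : ℝ), gaussLine t ((L : ℝ) * x + a + α - w)
      = ∫ u in (0 : ℝ)..(L : ℝ), ∫ w in (0 : ℝ)..(L : ℝ), gaussLine t ((L : ℝ) * x + u - w) := by
    have hg := sum_intervalIntegral_comp_add (h := fun u => ∫ w in (0 : ℝ)..(L : ℝ), gaussLine t ((L : ℝ) * x + u - w)) hcontw L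
    rw [← hg]
    refine Finset.sum_congr rfl fun a _ => intervalIntegral.integral_congr fun α _ => intervalIntegral.integral_congr fun w _ => ?_
    ring_nf
  rw [h3]
  -- Step 3: rescale both variables by `L` and use `g_t(Ly) = L⁻¹g_{t/L²}(y)`
  rw [intervalIntegral_zero_nat_eq_mul hL0]
  have h4 : ∀ α : ℝ, ∫ w in (0 : ℝ)..(L : ℝ), gaussLine t ((L : ℝ) * x + (L : ℝ) * α - w) = ∫ β in (0 : ℝ)..1, gaussLine (t / (L : ℝ) ^ 2) (x + α - β) := by
    intro α
    rw [intervalIntegral_zero_nat_eq_mul hL0, ← intervalIntegral.integral_const_mul]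
    refine intervalIntegral.integral_congr fun β _ => ?_
    rw [show (L : ℝ) * x + (L : ℝ) * α - (L : ℝ) * β = (L : ℝ) * (x + α - β) by ring, gaussLine_mul_left ht hL0, ← mul_assoc, mul_inv_cancel₀ hL0.ne', one_mul]
  simp_rw [h4]
  rw [tentAvg_gaussLine_eq_blockAverage htL x]

/-- The same with sums over `Fin L`. [folklore] -/
theorem sum_sum_fin_tentAvg_gaussLine_scaled {t : ℝ} (ht : 0 < t) {L : ℕ} (hL : 1 ≤ L) (x : ℝ) :
    ∑ i : Fin L, ∑ j : Fin L, ∫ u : ℝ, tent 1 u * gaussLine t ((L : ℝ) * x + ((i : ℕ) : ℝ) - ((j : ℕ) : ℝ) - u)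
      = (L : ℝ) * ∫ u : ℝ, tent 1 u * gaussLine (t / (L : ℝ) ^ 2) (x - u) := by
  rw [← sum_sum_tentAvg_gaussLine_scaled ht hL x]
  have inner : ∀ i : ℕ, ∑ j : Fin L, ∫ u : ℝ, tent 1 u * gaussLine t ((L : ℝ) * x + (i : ℝ) - ((j : ℕ) : ℝ) - u)
      = ∑ b ∈ Finset.range L, ∫ u : ℝ, tent 1 u * gaussLine t ((L : ℝ) * x + (i : ℝ) - (b : ℝ) - u) := fun i =>
    Fin.sum_univ_eq_sum_range (fun j : ℕ => ∫ u : ℝ, tent 1 u * gaussLine t ((L : ℝ) * x + (i : ℝ) - (j : ℝ) - u)) L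
  simp_rw [inner]
  exact Fin.sum_univ_eq_sum_range (fun i : ℕ => ∑ b ∈ Finset.range L, ∫ u : ℝ, tent 1 u * gaussLine t ((L : ℝ) * x + (i : ℝ) - (b : ℝ) - u)) L

/-! ## §2 All dimensions: the product over coordinates -/

/-- ★★ `Σ_{a,b∈[0,L)^{d+1}}Π_μJ_t(Lz_μ + a_μ − b_μ) = L^{d+1}Π_μJ_{t∕L²}(z_μ)` (`t > 0`, `L ≥ 1`). [folklore] -/
theorem sum_sum_prod_tentAvg_scaled {t : ℝ} (ht : 0 < t) {L : ℕ} (hL : 1 ≤ L) (z : Fin (d + 1) → ℝ) :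
    ∑ a : Fin (d + 1) → Fin L, ∑ b : Fin (d + 1) → Fin L, ∏ μ, ∫ u : ℝ, tent 1 u * gaussLine t ((L : ℝ) * z μ + ((a μ : ℕ) : ℝ) - ((b μ : ℕ) : ℝ) - u)
      = (L : ℝ) ^ (d + 1) * ∏ μ, ∫ u : ℝ, tent 1 u * gaussLine (t / (L : ℝ) ^ 2) (z μ - u) := by
  classical
  have hb : ∀ a : Fin (d + 1) → Fin L,
      ∑ b : Fin (d + 1) → Fin L, ∏ μ, ∫ u : ℝ, tent 1 u * gaussLine t ((L : ℝ) * z μ + ((a μ : ℕ) : ℝ) - ((b μ : ℕ) : ℝ) - u)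
        = ∏ μ, ∑ j : Fin L, ∫ u : ℝ, tent 1 u * gaussLine t ((L : ℝ) * z μ + ((a μ : ℕ) : ℝ) - ((j : ℕ) : ℝ) - u) := fun a =>
    (Fintype.prod_sum (fun μ (j : Fin L) => ∫ u : ℝ, tent 1 u * gaussLine t ((L : ℝ) * z μ + ((a μ : ℕ) : ℝ) - ((j : ℕ) : ℝ) - u))).symm
  have ha : ∑ a : Fin (d + 1) → Fin L, ∏ μ, ∑ j : Fin L, ∫ u : ℝ, tent 1 u * gaussLine t ((L : ℝ) * z μ + ((a μ : ℕ) : ℝ) - ((j : ℕ) : ℝ) - u)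
      = ∏ μ, ∑ i : Fin L, ∑ j : Fin L, ∫ u : ℝ, tent 1 u * gaussLine t ((L : ℝ) * z μ + ((i : ℕ) : ℝ) - ((j : ℕ) : ℝ) - u) :=
    (Fintype.prod_sum (fun μ (i : Fin L) => ∑ j : Fin L, ∫ u : ℝ, tent 1 u * gaussLine t ((L : ℝ) * z μ + ((i : ℕ) : ℝ) - ((j : ℕ) : ℝ) - u))).symm
  rw [Finset.sum_congr rfl fun a _ => hb a, ha]
  simp_rw [sum_sum_fin_tentAvg_gaussLine_scaled ht hL]
  rw [Finset.prod_mul_distrib, Finset.prod_const, Finset.card_univ, Fintype.card_fin]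

/-! ## §3 The renormalisation-group flow of the massive block field -/

/-- ★★★ **THE EXACT BLOCK-SPIN RG FLOW OF KING'S BLOCK FIELD**: for every `d`, `m² > 0`, `L ≥ 1` and `z ∈ ℤ^{d+1}`,
`Σ_{a,b∈[0,L)^{d+1}}S₂^{ℝ}_{m²}(Lz + a − b) = L^{d+3}·S₂^{ℝ}_{L²m²}(z)` — block-averaging over `L`-blocks and rescaling the field by `L^{(d−1)∕2}` reproduces King's block field with
mass `Lm`. [cite: King1986, §2 (2.3)–(2.6) p.652, Thm 2.1 (2.22) p.654, (4.5) p.670] -/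
theorem kingS2Inf_rg_flow {m2 : ℝ} (hm : 0 < m2) {L : ℕ} (hL : 1 ≤ L) (z : Fin (d + 1) → ℤ) :
    ∑ a : Fin (d + 1) → Fin L, ∑ b : Fin (d + 1) → Fin L, kingS2Inf m2 (fun μ => (L : ℤ) * z μ + ((a μ : ℕ) : ℤ) - ((b μ : ℕ) : ℤ))
      = (L : ℝ) ^ (d + 3) * kingS2Inf ((L : ℝ) ^ 2 * m2) z := by
  have hL0 : (0 : ℝ) < L := Nat.cast_pos.mpr (by omega)
  have hL2 : (0 : ℝ) < (L : ℝ) ^ 2 := by positivity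
  have hm' : 0 < (L : ℝ) ^ 2 * m2 := mul_pos hL2 hm
  -- Step 1: proper-time form of every term and exchange of the finite sums with the integral
  simp_rw [kingS2Inf_eq_integral_tent_gaussLine hm]
  have hI : ∀ a b : Fin (d + 1) → Fin L, IntegrableOn (fun t : ℝ => Real.exp (-(t * m2)) *
      ∏ μ, ∫ u : ℝ, tent 1 u * gaussLine t ((((L : ℤ) * z μ + ((a μ : ℕ) : ℤ) - ((b μ : ℕ) : ℤ) : ℤ) : ℝ) - u)) (Ioi 0) :=
    fun a b => integrableOn_tentForm hm (fun μ => (L : ℤ) * z μ + ((a μ : ℕ) : ℤ) - ((b μ : ℕ) : ℤ))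
  have hswap : ∀ a : Fin (d + 1) → Fin L,
      ∑ b : Fin (d + 1) → Fin L, ∫ t in Ioi (0 : ℝ), Real.exp (-(t * m2)) * ∏ μ, ∫ u : ℝ, tent 1 u * gaussLine t ((((L : ℤ) * z μ + ((a μ : ℕ) : ℤ) - ((b μ : ℕ) : ℤ) : ℤ) : ℝ) - u)
        = ∫ t in Ioi (0 : ℝ), ∑ b : Fin (d + 1) → Fin L, Real.exp (-(t * m2)) * ∏ μ, ∫ u : ℝ, tent 1 u * gaussLine t ((((L : ℤ) * z μ + ((a μ : ℕ) : ℤ) - ((b μ : ℕ) : ℤ) : ℤ) : ℝ) - u) :=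
    fun a => (integral_finsetSum _ fun b _ => hI a b).symm
  simp_rw [hswap]
  rw [← integral_finsetSum _ fun a _ => integrable_finsetSum _ fun b _ => hI a b]
  -- Step 2: inside the integral, the product identity of §2
  have hLne : (L : ℝ) ≠ 0 := hL0.ne'
  have hL2ne : (L : ℝ) ^ 2 ≠ 0 := hL2.ne'
  have hsite : ∀ (a b : Fin (d + 1) → Fin L) (μ : Fin (d + 1)),
      ((((L : ℤ) * z μ + ((a μ : ℕ) : ℤ) - ((b μ : ℕ) : ℤ) : ℤ)) : ℝ) = (L : ℝ) * (z μ : ℝ) + ((a μ : ℕ) : ℝ) - ((b μ : ℕ) : ℝ) := by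
    intro a b μ; push_cast; ring
  have hstep : ∀ t ∈ Ioi (0 : ℝ), ∑ a : Fin (d + 1) → Fin L, ∑ b : Fin (d + 1) → Fin L,
      Real.exp (-(t * m2)) * ∏ μ, ∫ u : ℝ, tent 1 u * gaussLine t ((((L : ℤ) * z μ + ((a μ : ℕ) : ℤ) - ((b μ : ℕ) : ℤ) : ℤ) : ℝ) - u)
      = Real.exp (-(((L : ℝ) ^ 2)⁻¹ * t * ((L : ℝ) ^ 2 * m2))) * ((L : ℝ) ^ (d + 1) * ∏ μ, ∫ u : ℝ, tent 1 u * gaussLine (((L : ℝ) ^ 2)⁻¹ * t) ((z μ : ℝ) - u)) := by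
    intro t ht
    simp_rw [hsite, ← Finset.mul_sum]
    rw [sum_sum_prod_tentAvg_scaled ht hL (fun μ => (z μ : ℝ)), div_eq_inv_mul]
    have he : -(t * m2) = -(((L : ℝ) ^ 2)⁻¹ * t * ((L : ℝ) ^ 2 * m2)) := by field_simp
    rw [he]
  rw [setIntegral_congr_fun measurableSet_Ioi hstep]
  -- Step 3: substitute `t = L²s`
  have hsub := integral_comp_mul_left_Ioi (E := ℝ) (fun s : ℝ => Real.exp (-(s * ((L : ℝ) ^ 2 * m2))) *
      ((L : ℝ) ^ (d + 1) * ∏ μ, ∫ u : ℝ, tent 1 u * gaussLine s ((z μ : ℝ) - u))) 0 (inv_pos.mpr hL2)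
  rw [mul_zero, inv_inv, smul_eq_mul] at hsub
  calc ∫ t in Ioi (0 : ℝ), Real.exp (-(((L : ℝ) ^ 2)⁻¹ * t * ((L : ℝ) ^ 2 * m2))) * ((L : ℝ) ^ (d + 1) * ∏ μ, ∫ u : ℝ, tent 1 u * gaussLine (((L : ℝ) ^ 2)⁻¹ * t) ((z μ : ℝ) - u))
      = ∫ t in Ioi (0 : ℝ), (fun s : ℝ => Real.exp (-(s * ((L : ℝ) ^ 2 * m2))) * ((L : ℝ) ^ (d + 1) * ∏ μ, ∫ u : ℝ, tent 1 u * gaussLine s ((z μ : ℝ) - u))) (((L : ℝ) ^ 2)⁻¹ * t) := rfl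
    _ = (L : ℝ) ^ 2 * ∫ s in Ioi (0 : ℝ), Real.exp (-(s * ((L : ℝ) ^ 2 * m2))) * ((L : ℝ) ^ (d + 1) * ∏ μ, ∫ u : ℝ, tent 1 u * gaussLine s ((z μ : ℝ) - u)) := hsub
    _ = (L : ℝ) ^ 2 * ((L : ℝ) ^ (d + 1) * ∫ s in Ioi (0 : ℝ), Real.exp (-(s * ((L : ℝ) ^ 2 * m2))) * ∏ μ, ∫ u : ℝ, tent 1 u * gaussLine s ((z μ : ℝ) - u)) := by
        congr 1
        rw [← integral_const_mul]
        exact integral_congr_ae (Filter.Eventually.of_forall fun s => mul_left_comm _ _ _)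
    _ = (L : ℝ) ^ (d + 3) * kingS2Inf ((L : ℝ) ^ 2 * m2) z := by
        rw [← kingS2Inf_eq_integral_tent_gaussLine hm' z]
        ring

/-- ★★★ **THE RG FLOW AT THE LEVEL OF THE FIELD**: under `μ_{∞,m}` the block sums `Φ_L(z) = Σ_{a∈[0,L)^{d+1}}φ(Lz + a)` have covariance `∫Φ_L(z)Φ_L(w)dμ_{∞,m} = L^{d+3}S₂^{ℝ}_{L²m²}(w − z)` — so the
rescaled block average `L^{(d−1)∕2}·L^{−(d+1)}Φ_L` is King's block field with mass `Lm` (at the covariance level; both are centred Gaussian). [cite: King1986, §2 (2.3)–(2.6) p.652, Thm 2.1 (2.22) p.654] -/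
theorem covariance_blockSum_kingFieldInf {m2 : ℝ} (hm : 0 < m2) {L : ℕ} (hL : 1 ≤ L) (z w : Fin (d + 1) → ℤ) :
    ∫ ω, (∑ a : Fin (d + 1) → Fin L, ω (fun μ => (L : ℤ) * z μ + ((a μ : ℕ) : ℤ))) * (∑ b : Fin (d + 1) → Fin L, ω (fun μ => (L : ℤ) * w μ + ((b μ : ℕ) : ℤ))) ∂kingFieldInf m2
      = (L : ℝ) ^ (d + 3) * kingS2Inf ((L : ℝ) ^ 2 * m2) (w - z) := by
  have hI : ∀ a b : Fin (d + 1) → Fin L, Integrable (fun ω : (Fin (d + 1) → ℤ) → ℝ =>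
      ω (fun μ => (L : ℤ) * z μ + ((a μ : ℕ) : ℤ)) * ω (fun μ => (L : ℤ) * w μ + ((b μ : ℕ) : ℤ))) (kingFieldInf m2) := fun a b =>
    integrable_eval_mul_eval_kingFieldInf hm _ _
  simp_rw [Finset.sum_mul_sum]
  rw [integral_finsetSum _ fun a _ => integrable_finsetSum _ fun b _ => hI a b]
  simp_rw [integral_finsetSum _ fun b _ => hI _ b, integral_eval_mul_eval_kingFieldInf hm]
  have hdiff : ∀ a b : Fin (d + 1) → Fin L, ((fun μ => (L : ℤ) * w μ + ((b μ : ℕ) : ℤ)) - fun μ => (L : ℤ) * z μ + ((a μ : ℕ) : ℤ))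
      = fun μ => (L : ℤ) * (w - z) μ + ((b μ : ℕ) : ℤ) - ((a μ : ℕ) : ℤ) := by
    intro a b; funext μ; simp only [Pi.sub_apply]; ring
  simp_rw [hdiff]
  rw [Finset.sum_comm]
  exact kingS2Inf_rg_flow hm hL (w - z)

/-! ## §4 The massless fixed point -/

/-- ★★★ **THE MASSLESS BLOCK FIELD IS AN RG FIXED POINT** (`d + 1 ≥ 3`): `Σ_{a,b∈[0,L)^{d+1}}S₂^{0}(Lz + a − b) = L^{d+3}S₂^{0}(z)` — block-averaging over `L`-blocks and rescaling by `L^{(d−1)∕2}`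
leaves the massless two-point function invariant (limit `m ↓ 0` of the flow). [cite: King1986, §2 (2.3)–(2.6) p.652, Thm 2.1 (2.22) p.654] -/
theorem kingS2Inf0_rg_fixed_point (hd : 2 ≤ d) {L : ℕ} (hL : 1 ≤ L) (z : Fin (d + 1) → ℤ) :
    ∑ a : Fin (d + 1) → Fin L, ∑ b : Fin (d + 1) → Fin L, kingS2Inf0 (fun μ => (L : ℤ) * z μ + ((a μ : ℕ) : ℤ) - ((b μ : ℕ) : ℤ))
      = (L : ℝ) ^ (d + 3) * kingS2Inf0 z := by
  have hL2 : (0 : ℝ) < (L : ℝ) ^ 2 := by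
    have hL0 : (0 : ℝ) < L := Nat.cast_pos.mpr (by omega)
    positivity
  have hleft : Tendsto (fun m2 : ℝ => ∑ a : Fin (d + 1) → Fin L, ∑ b : Fin (d + 1) → Fin L, kingS2Inf m2 (fun μ => (L : ℤ) * z μ + ((a μ : ℕ) : ℤ) - ((b μ : ℕ) : ℤ)))
      (𝓝[>] 0) (𝓝 (∑ a : Fin (d + 1) → Fin L, ∑ b : Fin (d + 1) → Fin L, kingS2Inf0 (fun μ => (L : ℤ) * z μ + ((a μ : ℕ) : ℤ) - ((b μ : ℕ) : ℤ)))) :=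
    tendsto_finsetSum _ fun a _ => tendsto_finsetSum _ fun b _ => tendsto_kingS2Inf_nhdsGT_zero hd _
  have hright : Tendsto (fun m2 : ℝ => (L : ℝ) ^ (d + 3) * kingS2Inf ((L : ℝ) ^ 2 * m2) z) (𝓝[>] 0) (𝓝 ((L : ℝ) ^ (d + 3) * kingS2Inf0 z)) :=
    ((tendsto_kingS2Inf_nhdsGT_zero hd z).comp (Literature.MathematicalPhysics.QuantumFieldTheory.UnitaryCayley.tendsto_const_mul_nhdsGT hL2)).const_mul _
  have hev : (fun m2 : ℝ => (L : ℝ) ^ (d + 3) * kingS2Inf ((L : ℝ) ^ 2 * m2) z)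
      =ᶠ[𝓝[>] 0] fun m2 : ℝ => ∑ a : Fin (d + 1) → Fin L, ∑ b : Fin (d + 1) → Fin L, kingS2Inf m2 (fun μ => (L : ℤ) * z μ + ((a μ : ℕ) : ℤ) - ((b μ : ℕ) : ℤ)) :=
    eventually_nhdsWithin_of_forall fun m2 hm2 => (kingS2Inf_rg_flow hm2 hL z).symm
  exact tendsto_nhds_unique hleft (hright.congr' hev)

/-- ★★★ **THE FIXED POINT AT THE LEVEL OF THE FIELD**: under the massless law `μ⁰_∞` (`d + 1 ≥ 3`) the block sums satisfy `∫Φ_L(z)Φ_L(w)dμ⁰_∞ = L^{d+3}S₂^{0}(w − z)`: the rescaled block average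
`L^{(d−1)∕2−(d+1)}Φ_L` has the covariance — hence, being centred Gaussian, the law — of `μ⁰_∞` itself. [cite: King1986, §2 (2.3)–(2.6) p.652, Thm 2.1 (2.22) p.654] -/
theorem covariance_blockSum_kingFieldInf0 (hd : 2 ≤ d) {L : ℕ} (hL : 1 ≤ L) (z w : Fin (d + 1) → ℤ) :
    ∫ ω, (∑ a : Fin (d + 1) → Fin L, ω (fun μ => (L : ℤ) * z μ + ((a μ : ℕ) : ℤ))) * (∑ b : Fin (d + 1) → Fin L, ω (fun μ => (L : ℤ) * w μ + ((b μ : ℕ) : ℤ))) ∂kingFieldInf0 d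
      = (L : ℝ) ^ (d + 3) * kingS2Inf0 (w - z) := by
  have hK := isPosSemidefKernel_kingKernel0 hd
  have hI : ∀ a b : Fin (d + 1) → Fin L, Integrable (fun ω : (Fin (d + 1) → ℤ) → ℝ =>
      ω (fun μ => (L : ℤ) * z μ + ((a μ : ℕ) : ℤ)) * ω (fun μ => (L : ℤ) * w μ + ((b μ : ℕ) : ℤ))) (kingFieldInf0 d) := by
    intro a b
    have hG : ProbabilityTheory.IsGaussianProcess (fun (s : Fin (d + 1) → ℤ) (ω : (Fin (d + 1) → ℤ) → ℝ) => ω s) (kingFieldInf0 d) :=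
      Literature.MathematicalPhysics.QuantumFieldTheory.isGaussianProcess_eval_gaussianFieldOfKernel hK
    exact (hG.hasGaussianLaw_eval _).memLp_two.integrable_mul (hG.hasGaussianLaw_eval _).memLp_two
  simp_rw [Finset.sum_mul_sum]
  rw [integral_finsetSum _ fun a _ => integrable_finsetSum _ fun b _ => hI a b]
  simp_rw [integral_finsetSum _ fun b _ => hI _ b, integral_eval_mul_eval_kingFieldInf0 hd]
  have hdiff : ∀ a b : Fin (d + 1) → Fin L, ((fun μ => (L : ℤ) * w μ + ((b μ : ℕ) : ℤ)) - fun μ => (L : ℤ) * z μ + ((a μ : ℕ) : ℤ))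
      = fun μ => (L : ℤ) * (w - z) μ + ((b μ : ℕ) : ℤ) - ((a μ : ℕ) : ℤ) := by
    intro a b; funext μ; simp only [Pi.sub_apply]; ring
  simp_rw [hdiff]
  rw [Finset.sum_comm]
  exact kingS2Inf0_rg_fixed_point hd hL (w - z)

end Summit.QuantumFields.YangMills.BalabanUVNodes.N15KingModelRung.ProperTime
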